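import Literature.Analysis.FluidPDE.BoundedAnnihilator
import Literature.Analysis.FluidPDE.DivCurlAnnihilator
import HarnessLib

/-!
# Liouville for bounded weakly harmonic fields, and the bounded `div`–`curl` annihilator lemma

Analysis/FluidPDE support file (all results proved) on the decomposition path of the named facts
`Literature.Analysis.FluidPDE.biotSavart_curl_eq_self` (`Vorticity.lean`: a `C¹` divergence-free
field vanishing at infinity with integrable bounded curl is the Biot–Savart velocity of its curl;
Majda–Bertozzi, *Vorticity and Incompressible Flow*, §2.4.1 Prop. 2.16 with the Liouville
uniqueness argument) and, through it, `Literature.Analysis.FluidPDE.MajdaBertozzi2002_holderEulerUniqueness`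
(`ElgindiAprioriBlowupProofs.lean`). The uniqueness half of the Biot–Savart representation is a
Liouville theorem: the difference `w = u − K₃ * curl u` is bounded, weakly divergence free and
weakly irrotational, hence constant, hence zero since it vanishes at infinity (Majda–Bertozzi,
proof of Prop. 2.16, p. 64 of the held text; Koch–Nadirashvili–Seregin–Šverák 2009, Lemma 3.1,
arXiv:0709.3599 p. 7: "bounded solutions of the system `curl z = 0` and `div z = 0` in `ℝⁿ` are
constant by Liouville's theorem"). Since `K₃ * ω` is not known to be `C¹` for a merely
continuous `ω`, irrotationality must be used weakly, as annihilation of the *curl-type* test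
fields `(∂ₐg) c − (∂_c g) a` of the tree (`DivCurlAnnihilator.lean`), and this file supplies the
`L^∞` statements in that form (the tree has the `L^p + L^q` form,
`IsWeaklyDivFree.ae_eq_zero_of_add_memLp_of_forall_integral_inner_curlPair_eq_zero`, and the
`L^∞` form for annihilation of *all* solenoidal tests,
`IsWeaklyDivFree.exists_ae_eq_const_of_norm_le_of_forall_integral_inner_eq_zero`,
`BoundedAnnihilator.lean`):

* `exists_ae_eq_const_of_norm_le_of_forall_integral_laplacian_mul_inner_eq_zero` — **Liouville
  for bounded weakly harmonic fields**: a bounded a.e.-strongly measurable `w : E → E` all of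
  whose components are weakly harmonic (`∫ Δθ ⟪w, a⟫ = 0` for scalar tests `θ`) is a.e. equal
  to a constant (the engine of the `BoundedAnnihilator` proof, isolated: mollify, Liouville for
  bounded harmonic functions `HarmonicOnNhd.apply_eq_apply_of_abs_le`, Lebesgue
  differentiation);
* `IsWeaklyDivFree.exists_ae_eq_const_of_norm_le_of_forall_integral_inner_curlPair_eq_zero` —
  **the bounded `div`–`curl` annihilator lemma**: bounded, weakly divergence free and annihilating
  the curl-type fields ⟹ a.e. constant (weak harmonicity of the components is the tree's
  `integral_laplacian_mul_inner_eq_zero_of_curlPair`);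
* continuous versions: such a continuous field *is* constant
  (`IsWeaklyDivFree.exists_eq_const_of_continuous_of_forall_integral_inner_curlPair_eq_zero`),
  and vanishes identically if it tends to `0` at infinity
  (`IsWeaklyDivFree.eq_zero_of_tendsto_cocompact_of_forall_integral_inner_curlPair_eq_zero`) —
  the form used for `u − K₃ * curl u`.

## References

* A. J. Majda, A. L. Bertozzi, *Vorticity and Incompressible Flow* (CUP 2002), §2.4.1,
  Prop. 2.16 and its proof (p. 63–64 of the held text). [MajdaBertozziCUP2002]
* G. Koch, N. Nadirashvili, G. Seregin, V. Šverák, *Liouville theorems for the Navier–Stokes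
  equations and applications*, Acta Math. 203 (2009) = arXiv:0709.3599, Lemma 3.1 (p. 7).
  [KochNadirashviliSereginSverak2009]
* P. G. Lemarié-Rieusset, *The Navier–Stokes problem in the 21st century*, CRC Press 2016,
  proof of Thm. 4.4 (pp. 56–57). [LemarieRieusset2016]
-/

noncomputable section

open MeasureTheory TopologicalSpace Set Function Filter Topology InnerProductSpace
  ContinuousLinearMap Metric
open scoped RealInnerProductSpace ENNReal NNReal Convolution ContDiff Laplacian

namespace Literature.Analysis.FluidPDE

variable {E : Type*} [NormedAddCommGroup E] [InnerProductSpace ℝ E] [FiniteDimensional ℝ E]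
  [MeasurableSpace E] [BorelSpace E]

/-! ### Liouville for bounded weakly harmonic fields -/

/-- **Liouville for bounded weakly harmonic fields.** Let `E` be a finite-dimensional real inner
product space with its Lebesgue measure. If `w : E → E` is a.e. strongly measurable and bounded
(`‖w‖ ≤ M`) and every component is weakly harmonic, `∫ (Δθ) ⟪w, a⟫ = 0` for all scalar test
functions `θ` and all `a ∈ E`, then `w` is a.e. equal to a constant. Proof as in the tree's
`IsWeaklyDivFree.exists_ae_eq_const_of_norm_le_of_forall_integral_inner_eq_zero`
(Lemarié-Rieusset 2016, proof of Thm. 4.4, run on mollifications): the components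
`hₖ = φₖ ⋆ ⟪w, a⟫` of the mollifications are harmonic and bounded, hence constant
(`HarmonicOnNhd.apply_eq_apply_of_abs_le`), and `hₖ → ⟪w, a⟫` a.e. (KNSS 2009, Lemma 3.1:
bounded harmonic ⟹ constant.) [cite: KochNadirashviliSereginSverak2009, Lemma 3.1 (arXiv p. 7)] -/
theorem exists_ae_eq_const_of_norm_le_of_forall_integral_laplacian_mul_inner_eq_zero
    {w : E → E} (hw : AEStronglyMeasurable w volume) {M : ℝ} (hM : ∀ x, ‖w x‖ ≤ M)
    (hharm : ∀ θ : E → ℝ, FunctionSpaces.IsTestFunctionOn (⊤ : Opens E) θ → ∀ a : E,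
      ∫ x, (Δ θ) x * ⟪w x, a⟫ = 0) :
    ∃ c : E, w =ᵐ[volume] fun _ => c := by
  set b := stdOrthonormalBasis ℝ E
  have hwtop : MemLp w (⊤ : ℝ≥0∞) (volume : Measure E) :=
    memLp_top_of_bound hw M (Eventually.of_forall hM)
  obtain ⟨φ, hφ0, hφ2⟩ := FunctionSpaces.exists_contDiffBump_seq (E := E)
  -- every component `⟪w, a⟫` is a.e. equal to a constant
  have hcomp : ∀ a : E, ∃ c : ℝ, ∀ᵐ y ∂(volume : Measure E), ⟪w y, a⟫ = c := by
    intro a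
    set wa : E → ℝ := fun y => ⟪w y, a⟫ with hwa_def
    have hwal : LocallyIntegrable wa volume := (hwtop.inner_const a).locallyIntegrable le_top
    have hwab : ∀ y, |wa y| ≤ M * ‖a‖ := fun y =>
      (abs_real_inner_le_norm _ _).trans (mul_le_mul_of_nonneg_right (hM y) (norm_nonneg _))
    -- each mollification is a bounded harmonic function, hence constant
    have hconst : ∀ (k : ℕ) (x : E), ((φ k).normed volume ⋆[lsmul ℝ ℝ, volume] wa) x =
        ((φ k).normed volume ⋆[lsmul ℝ ℝ, volume] wa) 0 := by
      intro k
      set ψ : E → ℝ := (φ k).normed volume with hψ_def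
      have hψ : FunctionSpaces.IsTestFunctionOn (⊤ : Opens E) ψ :=
        FunctionSpaces.isTestFunctionOn_normed (φ k)
      have hψ2 : ContDiff ℝ 2 ψ := contDiff_infty.1 hψ.contDiff 2
      have hh2 : ContDiff ℝ 2 (ψ ⋆[lsmul ℝ ℝ, volume] wa) :=
        hψ.hasCompactSupport.contDiff_convolution_left _ hψ2 hwal
      have hΔ : ∀ x, Δ (ψ ⋆[lsmul ℝ ℝ, volume] wa) x = 0 := by
        intro x
        rw [laplacian_convolution_lsmul hψ2 hψ.hasCompactSupport hwal x, convolution_def]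
        simp only [lsmul_apply, smul_eq_mul]
        have e := integral_sub_left_eq_self (fun t => (Δ ψ) t * wa (x - t)) volume x
        simp only [sub_sub_cancel] at e
        rw [← e]
        have hθ : FunctionSpaces.IsTestFunctionOn (⊤ : Opens E) (fun z => ψ (x - z)) :=
          hψ.comp_sub_left x
        have key := hharm _ hθ a
        simp_rw [laplacian_comp_sub_left hψ2 x] at key
        exact key
      have hharm' : HarmonicOnNhd (ψ ⋆[lsmul ℝ ℝ, volume] wa) univ := fun x _ =>
        ⟨hh2.contDiffAt, Eventually.of_forall fun y => hΔ y⟩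
      have hbdd : ∀ x, |(ψ ⋆[lsmul ℝ ℝ, volume] wa) x| ≤ M * ‖a‖ := fun x =>
        abs_normed_convolution_le (φ k) hwab x
      exact fun x => hharm'.apply_eq_apply_of_abs_le hbdd x 0
    -- the constants converge to `⟪w, a⟫` a.e.
    have hlim := FunctionSpaces.ae_tendsto_normed_convolution hφ0 hφ2 hwal
    refine ⟨limUnder atTop fun k => ((φ k).normed volume ⋆[lsmul ℝ ℝ, volume] wa) 0, ?_⟩
    filter_upwards [hlim] with x hx
    simp_rw [hconst] at hx
    exact (hx.limUnder_eq).symm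
  -- assemble along an orthonormal frame
  choose c hc using hcomp
  have hall : ∀ᵐ y ∂(volume : Measure E), ∀ i, ⟪w y, b i⟫ = c (b i) :=
    ae_all_iff.2 fun i => hc (b i)
  refine ⟨∑ i, c (b i) • b i, ?_⟩
  filter_upwards [hall] with y hy
  rw [← b.sum_repr' (w y)]
  exact Finset.sum_congr rfl fun i _ => by rw [real_inner_comm, hy i]

/-! ### The bounded `div`–`curl` annihilator lemma -/

/-- **The bounded `div`–`curl` annihilator lemma** (a bounded field which is weakly solenoidal and
weakly irrotational is constant). If `w : E → E` is a.e. strongly measurable, bounded, weakly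
divergence free (`∫ ⟪w, ∇θ⟫ = 0`) and annihilates every curl-type field,
`∫ ⟪w, (∂ₐg) c − (∂_c g) a⟫ = 0` for all scalar test functions `g` and `a, c ∈ E`, then `w` is
a.e. equal to a constant: its components are weakly harmonic
(`integral_laplacian_mul_inner_eq_zero_of_curlPair`, the weak form of
`ΔF = ∇ div F − curl curl F`) and the previous lemma applies (KNSS 2009, Lemma 3.1, arXiv p. 7:
"bounded solutions of the system `curl z = 0` and `div z = 0` in `ℝⁿ` are constant by
Liouville's theorem"; Majda–Bertozzi, proof of Prop. 2.16). [cite: KochNadirashviliSereginSverak2009, Lemma 3.1 (arXiv p. 7)] -/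
theorem IsWeaklyDivFree.exists_ae_eq_const_of_norm_le_of_forall_integral_inner_curlPair_eq_zero
    {w : E → E} (hw : AEStronglyMeasurable w volume) {M : ℝ} (hM : ∀ x, ‖w x‖ ≤ M)
    (hdiv : IsWeaklyDivFree w)
    (hcurl : ∀ g : E → ℝ, FunctionSpaces.IsTestFunctionOn (⊤ : Opens E) g → ∀ a c : E,
      ∫ x, ⟪w x, fderiv ℝ g x a • c - fderiv ℝ g x c • a⟫ = 0) :
    ∃ c : E, w =ᵐ[volume] fun _ => c :=
  exists_ae_eq_const_of_norm_le_of_forall_integral_laplacian_mul_inner_eq_zero hw hM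
    fun _ hθ a => integral_laplacian_mul_inner_eq_zero_of_curlPair
      ((memLp_top_of_bound hw M (Eventually.of_forall hM)).locallyIntegrable le_top) hdiv hcurl hθ a

/-- **Continuous version**: a bounded continuous field which is weakly divergence free and
annihilates the curl-type fields is constant (everywhere: two continuous functions which agree
a.e. for Lebesgue measure agree). [cite: KochNadirashviliSereginSverak2009, Lemma 3.1 (arXiv p. 7)] -/
theorem IsWeaklyDivFree.exists_eq_const_of_continuous_of_forall_integral_inner_curlPair_eq_zero
    {w : E → E} (hwc : Continuous w) {M : ℝ} (hM : ∀ x, ‖w x‖ ≤ M) (hdiv : IsWeaklyDivFree w)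
    (hcurl : ∀ g : E → ℝ, FunctionSpaces.IsTestFunctionOn (⊤ : Opens E) g → ∀ a c : E,
      ∫ x, ⟪w x, fderiv ℝ g x a • c - fderiv ℝ g x c • a⟫ = 0) :
    ∃ c : E, w = fun _ => c := by
  obtain ⟨c, hc⟩ :=
    hdiv.exists_ae_eq_const_of_norm_le_of_forall_integral_inner_curlPair_eq_zero
      hwc.aestronglyMeasurable hM hcurl
  exact ⟨c, (hwc.ae_eq_iff_eq volume continuous_const).1 hc⟩

/-- **A continuous field which is weakly divergence free, weakly irrotational and vanishes at
infinity is identically zero** — the uniqueness half of the Biot–Savart representation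
(Majda–Bertozzi, proof of Prop. 2.16, p. 64 of the held text: the difference of two solutions of
`curl v = ω`, `div v = 0` vanishing at infinity is zero by Liouville; applied in
`biotSavart_curl_eq_self` to `u − K₃ * curl u`). Boundedness is automatic: a continuous function
tending to `0` along the cocompact filter is bounded. [cite: MajdaBertozziCUP2002, §2.4.1 proof of Prop. 2.16 (p. 64 of the held text)] -/
theorem IsWeaklyDivFree.eq_zero_of_tendsto_cocompact_of_forall_integral_inner_curlPair_eq_zero
    {w : E → E} (hwc : Continuous w) (h0 : Tendsto w (cocompact E) (𝓝 0))
    (hdiv : IsWeaklyDivFree w)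
    (hcurl : ∀ g : E → ℝ, FunctionSpaces.IsTestFunctionOn (⊤ : Opens E) g → ∀ a c : E,
      ∫ x, ⟪w x, fderiv ℝ g x a • c - fderiv ℝ g x c • a⟫ = 0) :
    w = 0 := by
  -- boundedness: `‖w‖ ≤ 1` off a compact set, and `w` is bounded on that compact set
  have hev : ∀ᶠ x in cocompact E, ‖w x‖ ≤ 1 := by
    have : ∀ᶠ x in cocompact E, w x ∈ Metric.closedBall (0 : E) 1 :=
      h0 (Metric.closedBall_mem_nhds 0 one_pos)
    filter_upwards [this] with x hx
    simpa using hx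
  obtain ⟨K, hK, hKw⟩ : ∃ K : Set E, IsCompact K ∧ ∀ x ∉ K, ‖w x‖ ≤ 1 := by
    obtain ⟨K, hK, hsub⟩ := mem_cocompact.1 hev
    exact ⟨K, hK, fun x hx => hsub hx⟩
  obtain ⟨M₀, hM₀⟩ := hK.exists_bound_of_continuousOn hwc.continuousOn
  have hM : ∀ x, ‖w x‖ ≤ max M₀ 1 := fun x => by
    by_cases hx : x ∈ K
    · exact (hM₀ x hx).trans (le_max_left _ _)
    · exact (hKw x hx).trans (le_max_right _ _)
  obtain ⟨c, hc⟩ :=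
    hdiv.exists_eq_const_of_continuous_of_forall_integral_inner_curlPair_eq_zero hwc hM hcurl
  -- the constant vanishes since `w → 0` at infinity (or the space is trivial)
  rcases subsingleton_or_nontrivial E with hE | hE
  · funext x
    exact Subsingleton.elim _ _
  · have hc0 : c = 0 := by
      rw [hc] at h0
      exact tendsto_const_nhds_iff.1 h0
    rw [hc, hc0]
    rfl

end Literature.Analysis.FluidPDE
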